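import Summits.CriticalPhenomena.SAWScalingLimit.Theorems.SAWRenewalTightnessTubeLowerBoundOctantReduction
import Summits.CriticalPhenomena.SAWScalingLimit.Theorems.SAWRenewalTightnessTubeLowerBoundDoublingUpgrade
import Summits.CriticalPhenomena.SAWScalingLimit.Theorems.SAWRenewalTightnessTubeLowerBoundDiamondStaircase
import Summits.CriticalPhenomena.SAWScalingLimit.Theorems.TubeLowerBound.Negative.TubeLowerBoundFixedWidth

/-!
# Line `bridge-doubling-tower` for crux `SAWRenewalTightness.TubeLowerBound` (stmt-CriticalPhenomena-4730)

LEAD c2 STATUS 2026-08-16T16:45Z (prover-line-stmt-CriticalPhenomena-4730-c2-0): S2 `stub_doublingUpgrade` LANDED p99271 (lead -1),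
S3 `stub_diamondStaircase` LANDED p113072 (lead c2), both wired in by name below; ONLY S1 `stub_wedgeSlabFloor` (open floor) carries
a `sorry`.  LEAD RESHAPE r2 (prover-line-stmt-CriticalPhenomena-4730-1, 2026-08-16; planner skeleton = crux-plan round 1,
idea `bridge-doubling-tower`, triage r1-1/r1-2/r1-3: pass).  Change w.r.t. the planner's skeleton: S3 is re-targeted
to the LANDED statement `FirstOctantTubeFloor` of the sibling line (`Theorems/SAWRenewalTightnessTubeLowerBoundDefs.lean`,
p76932): the diamond staircase is only built for `v = (a, b)` with naturals `b ≤ a`, and the dihedral/translation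
transport to every pair `(u, v)` and the passage `TightTubeFloor ↔ TubeLowerBound` are the landed theorems
`LiebSimonStar.stub_octantReduction` (p80734) and `LiebSimonStar.tightTubeFloor_iff_crux`.  Same composition idea
(S1 → S2 → S3 → crux), fewer new proofs; S1 and S2 are the planner's statements VERBATIM.

THE LINE. `TubeLowerBound` (pointwise polynomial lower bound `c ℓ^{-C}` for the `x_c`-mass of SAWs `u → v` confined
to the `(ℓ/10+2)`-tube of the segment `[u,v]`, ALL directions) is reduced to ONE transversally confined,
one-directional, apex-started floor (S1) by two unconditional lemmas and two landed ones:

* S1 `stub_wedgeSlabFloor` (OPEN, hardest — the RSW-type input): for every span `l ≥ 1` the `x_c`-mass of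
  `e₁`-bridges of span `l` from the origin that stay in the START WEDGE `|y| < x` (times `≥ 1`) and in the tube
  `5|y| ≤ l`, endpoint FREE on the line `x = l`, is `≥ c l^{-C}` (some partial sum in the length).
* S2 `stub_doublingUpgrade` (provable now, M): S1 ⇒ pointwise polynomial floor for DIAMOND PIECES of every span
  `s ≥ 1`: SAWs `0 → (s,0)` whose points at times `1 ≤ i < n` satisfy `|y| < min(x, s-x)` and all of whose points
  satisfy `10|y| ≤ s`.  Mechanism = Madras–Slade Lemma 4.1.12 (reflect-and-Schwarz, book p.85): a wedge bridge
  `0 → (l,y)`, one `e₁` step (two for even spans), and the time-reversed mirror image in `x = l + 1/2` (`x = l+1`) of a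
  second wedge bridge `0 → (l,y)` form a diamond piece `0 → (2l+1+e, 0)`; pairing equal end heights and Cauchy–Schwarz
  over the `2⌊l/5⌋+1 ≤ l` heights give `h(2l+1+e) ≥ x_c^{1+e} F(l)²/l`, so `h(s) ≥ x_c² c² s^{-(2C+1)}` (constants
  free); `s = 1, 2`: the straight walk.  The start wedge of the INPUT is what makes the mirrored half satisfy the end
  wedge.  In-tree template: `Theorems/SAWRenewalTightnessTubeLowerBoundMirrorPin.lean` (the same argument for the
  one-sided reach family; its gluing lemmas `mirrorPin_glue_mem_sawFun`, `mirrorPin_schwarz_pairing` are generic).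
* S3 `stub_diamondStaircase` (provable now, M–L; RESHAPED target): diamond-piece floor ⇒ `FirstOctantTubeFloor`, i.e. for
  naturals `b ≤ a`, with `ℓ₀ = max(1, |(a,b)|)`, the `x_c`-mass of SAWs `0 → (a,b)` all of whose vertices lie within
  `ℓ₀/10 + 2` of `[0,(a,b)]` is `≥ c' ℓ₀^{-C'}`.  Mechanism: `n = min(20, a)` rounds through the lattice points
  `Q_j = (⌊ja/n⌋, ⌊jb/n⌋)` (the corner bookkeeping `CornerStaircase.xc/yc/corner_facts` of the sibling line is reusable
  verbatim): a horizontal diamond piece of span `x_{j+1} - x_j` from `Q_j` to `(x_{j+1}, y_j)`, then a vertical diamond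
  piece (coordinate swap, `CornerStaircase.tubeMass_swap_le`) of span `y_{j+1} - y_j` to `Q_{j+1}` (empty when the span
  is `0`).  SELF-AVOIDANCE IS FREE and is fed to `CornerStaircase.tubeMass_concat` as its separation hypothesis: with
  `φ = x + y`, every INTERIOR point of a piece lies strictly inside the open `φ`-slab between its two corners (east piece
  from `P`: `x - P_x > |y - P_y| ≥ -(y - P_y)` gives `φ > φ(P)`, and `|y - P_y| < s - (x - P_x)` gives `φ < φ(P) + s`;
  north pieces likewise), corners have non-decreasing `φ` (equal only across empty pieces, which are single points), so
  the staircase built so far lies in `{φ < φ(Q)} ∪ {Q}` and the new piece from `Q` in `{Q} ∪ {φ > φ(Q)}`: they meet only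
  at the gluing point, which is exactly `tubeMass_concat`'s `hsep`.  TUBE (`infDist_segment_le_coord` with
  `s = p_x / a`): a point of round `j+1` has `|a p_y - b p_x| / a ≤ (y-extent of the legs) + (piece half-width)
  ≤ (a/n + 1) + (a/n + 1)/10 + 1 ≤ a/10 + 2 ≤ ℓ₀/10 + 2` for `n = 20 ≤ a` (for `a < 20`, `n = a`, every piece has span
  `≤ 1` or is a unit-step column, deviation `< 2`).  MASS: `2n ≤ 40` pieces of span `≤ a ≤ ℓ₀`, each `≥ min(c,1) ℓ₀^{-C}`
  (span `0`: the trivial walk, mass `1`): `≥ min(c,1)^{40} ℓ₀^{-40C}`; `a = b = 0`: the trivial walk.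
  In-tree template: `Theorems/SAWRenewalTightnessTubeLowerBoundCornerStaircase(.Helpers).lean`.
* `TubeLowerBound_of` (proved here): `tightTubeFloor_iff_crux.1 ∘ stub_octantReduction ∘ S3 ∘ S2 (S1)` — the crux BY NAME.

S1 and S2 are stated over TREE VOCABULARY ONLY (`SAW.Zd.saws`, `SAW.criticalFugacity`; no local `def`), S3 concludes the
landed `FirstOctantTubeFloor`; each stub lands verbatim as
`Summits/CriticalPhenomena/SAWScalingLimit/Theorems/SAWRenewalTightnessTubeLowerBound<Stub>.lean`
(`--supports stmt-CriticalPhenomena-4730`, namespace `Summit.CriticalPhenomena.SAWScalingLimit.Theorems.TubeLowerBound.BridgeDoublingTower`)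
without importing this workfile.

Disproof.lean (cdisprove cycles 1–2, `Cruxes/TubeLowerBound/Disproof.lean` v2 of 05:33Z, read in full; landed as
`Theorems/TubeLowerBound/Negative/TubeLowerBoundLoadBearing|FixedWidth|SubcriticalRenewalFloorTargets`, the second is
IMPORTED here and an `example` restates it) honoured: `constraints` / `exponent_eq_zero_of_withoutOneLe` — every floor
carries `0 ≤ C`, S3 works at `ℓ₀ ≥ 1` and the composition only enlarges `ℓ`; `not_allN` — `∃ N` partial sums throughout;
`not_withoutSlack` — the `+2` is kept (FirstOctantTubeFloor) and spent on lattice rounding in S3; `not_withoutDist` — every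
confining region WIDENS linearly with the span (`5|y| ≤ l`, `10|y| ≤ s`, `ℓ₀/10 + 2`), no fixed-width strip anywhere;
`not_atFugacity_of_lt` — criticality enters at S1 only (S2, S3 are fugacity-free injections valid for every weight in
`(0,1]`; S1 is false below `x_c` by the refuter's exponential decay, so any proof of S1 must use `x = x_c`);
`tightTubeFloor_iff` — acknowledged: S3's target composed with the octant reduction IS the crux at scale `ℓ₀`;
`coneMass_eq_zero` / `coneBridgeFloor_kappa_le` (the end cone of the sibling `ConeBridgeFloor` pins the start) — checked
against: here the wedge conditions are imposed at times `1 ≤ i` (S1) and `1 ≤ i < n` (S2) only, so the apex/endpoints are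
exempt and the straight walk lies in every family (S1 at `l = 1, 2` is exactly `x_c^l`); `twoPoint_floor` — consistent
(the diamond floor is a confined pointwise axis two-point floor, downstream of the open S1).  No stub is an instance of a
refuted variant; `ledger negatives --problem CriticalPhenomena`: nothing on bridge / tube / crossing floors.
-/

noncomputable section

namespace Summit.CriticalPhenomena.SAWScalingLimit.Cruxes.TubeLowerBound.BridgeDoublingTower

open scoped BigOperators Classical
open Literature.Probability.LatticeModels Literature.Probability.RandomPlanarGeometry
open Summit.CriticalPhenomena.SAWScalingLimit.Theses.SAWRenewalTightness (TubeLowerBound)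
open Summit.CriticalPhenomena.SAWScalingLimit.Theorems.TubeLowerBound.LiebSimonStar
  (FirstOctantTubeFloor TightTubeFloor stub_octantReduction tightTubeFloor_iff_crux)

/-! ## The stubs -/

/-- **S1 `stub_wedgeSlabFloor` — WEDGE-SLAB FLOOR (the RSW-type input; OPEN, hardest stub, the lead's).**
There are `C ≥ 0`, `c > 0` such that for every span `l ≥ 1` the `x_c`-mass of self-avoiding walks `ω`
from `0` with `ω(n)` on the line `x = l` (endpoint height FREE), which are `e₁`-bridges of span `l`
(`0 < x ≤ l` after time `0`) staying in the start wedge `|y| < x` (all times `≥ 1`) and in the tube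
`5|y| ≤ l` (all times), is at least `c l^{-C}` (some partial sum in the length already exceeds it).
The `T = ∞`, wedge-free shadow is Kesten's span-renewal floor `u_l ≥ l^{-C}` (Madras–Slade (4.2.9)–(4.2.12)
at `z = z_c`; even `u_l → 0` has "no known proof", book p.92).  Heuristic value `≍ l^{-7/8}` (cone(90°)+line
exponents of SLE_{8/3}); aspect ratio 5 costs a constant.  Why it might fail / why it resists: no RSW or
lower-bound technology for `x_c`-SAW on `ℤ²` (Madras–Slade p.259: no bound `q_N ≥ const N^{-p} μ^N` known); the
hexagonal `B_T ≥ c/T` comes from the parafermionic observable; Kesten's `Σ_{T ≤ Λ} A_T(z_c) ≥ ½ log(Λ z_c)`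
cannot be localised in `T` because `A_T ≤ 1` is the only ceiling.  `l = 1, 2`: the family is the straight walk,
mass `x_c^l`. -/
theorem stub_wedgeSlabFloor :
    ∃ C c : ℝ, 0 ≤ C ∧ 0 < c ∧ ∀ l : ℕ, 1 ≤ l → ∃ N : ℕ,
      c * (l : ℝ) ^ (-C) ≤
        ∑ n ∈ Finset.range (N + 1),
          ∑ _ω ∈ (SAW.Zd.saws 2 n).filter (fun ω =>
              ω n 0 = (l : ℤ) ∧
              (∀ i, 1 ≤ i → i ≤ n → |ω i 1| < ω i 0 ∧ ω i 0 ≤ (l : ℤ)) ∧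
              (∀ i ≤ n, 5 * |ω i 1| ≤ (l : ℤ))),
            SAW.criticalFugacity ^ n := by
  sorry

/-- **S2 `stub_doublingUpgrade` — DOUBLING UPGRADE: wedge-slab floor ⇒ pointwise diamond-piece floor
(provable now, M; planner's statement verbatim).**
If S1's conclusion holds then there are `C' ≥ 0`, `c' > 0` such that for every span `s ≥ 1` the `x_c`-mass of
DIAMOND PIECES of span `s` — self-avoiding walks `0 → (s, 0)` whose points at times `1 ≤ i < n` satisfy `|y| < x`
and `|y| < s - x`, and all of whose points satisfy `10|y| ≤ s` — is at least `c' s^{-C'}` (e.g. `C' = 2C+1`,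
`c' = x_c² min(c,1)²`).
Proof route (Madras–Slade 1993 Lemma 4.1.12, p.85, "reflect-and-Schwarz"): for `l ≥ 1` and wedge bridges
`ω, ω'` of span `l` (S1's family) with the SAME endpoint `(l, y)`, the walk `ω`, then the step
`(l,y) → (l+1,y)`, then the reversed mirror image of `ω'` in the line `x = l + 1/2`
(`(x',y') ↦ (2l+1-x', y')`; tree: `SAW.Zd.reflAt 0 (2l+1)`, or the `Glues` device of
`SAWRenewalTightnessTubeLowerBoundMirrorPin.lean`) is a diamond piece of span `2l+1` (the start wedge
`|y'| < x'` of `ω'` becomes the end wedge `|y| < 2l+1-x`; halves live in the columns `x ≤ l`, `x ≥ l+1`; tube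
`5|y| ≤ l ⇒ 10|y| ≤ 2l+1`), injectively in `(ω, ω')` (cut at the unique crossing of `x = l + 1/2`); two
bridging steps give span `2l+2`.  Hence, with `F(l)` = S1's sum and `a_y` its part with endpoint height `y`
(`|y| ≤ ⌊l/5⌋`): `h(2l+1+e) ≥ x_c^{1+e} Σ_y a_y² ≥ x_c^{1+e} F(l)²/(2⌊l/5⌋+1) ≥ x_c² c² l^{-2C}/l ≥ x_c² c² s^{-(2C+1)}`
(`sq_sum_le_card_mul_sum_sq`); spans `s = 1, 2`: the straight walk (`SAW.Zd.straightWalk`). -/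
theorem stub_doublingUpgrade :
    (∃ C c : ℝ, 0 ≤ C ∧ 0 < c ∧ ∀ l : ℕ, 1 ≤ l → ∃ N : ℕ,
      c * (l : ℝ) ^ (-C) ≤
        ∑ n ∈ Finset.range (N + 1),
          ∑ _ω ∈ (SAW.Zd.saws 2 n).filter (fun ω =>
              ω n 0 = (l : ℤ) ∧
              (∀ i, 1 ≤ i → i ≤ n → |ω i 1| < ω i 0 ∧ ω i 0 ≤ (l : ℤ)) ∧
              (∀ i ≤ n, 5 * |ω i 1| ≤ (l : ℤ))),
            SAW.criticalFugacity ^ n) →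
    ∃ C c : ℝ, 0 ≤ C ∧ 0 < c ∧ ∀ s : ℕ, 1 ≤ s → ∃ N : ℕ,
      c * (s : ℝ) ^ (-C) ≤
        ∑ n ∈ Finset.range (N + 1),
          ∑ _ω ∈ (SAW.Zd.saws 2 n).filter (fun ω =>
              ω n 0 = (s : ℤ) ∧ ω n 1 = 0 ∧
              (∀ i, 1 ≤ i → i < n → |ω i 1| < ω i 0 ∧ |ω i 1| < (s : ℤ) - ω i 0) ∧
              (∀ i ≤ n, 10 * |ω i 1| ≤ (s : ℤ))),
            SAW.criticalFugacity ^ n :=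
  Summit.CriticalPhenomena.SAWScalingLimit.Theorems.TubeLowerBound.BridgeDoublingTower.stub_doublingUpgrade  -- LANDED p99271 (lead -1)

/-- **S3 `stub_diamondStaircase` — DIAMOND STAIRCASE (provable now, M–L; LEAD RESHAPE: target = the landed
`FirstOctantTubeFloor`).**  If diamond pieces of every span `s ≥ 1` have `x_c`-mass `≥ c s^{-C}` (S2's conclusion),
then `FirstOctantTubeFloor` holds: there are `C' ≥ 0`, `c' > 0` such that for all naturals `b ≤ a`, with
`ℓ₀ := max(1, |(a,b)|)`, some partial sum of the `x_c`-mass of self-avoiding walks `0 → (a, b)` all of whose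
vertices lie within `ℓ₀/10 + 2` of the segment `[0, (a,b)]` is `≥ c' ℓ₀^{-C'}` (e.g. `C' = 40C`,
`c' = min(c,1)^{40}`).
Proof route.  (0) Rewrite S2's family as a confined two-point family in the shape used by the sibling line's
helpers: `{ω ∈ sawFun 2 n (s,0) | ∀ i ≤ n, D_s (ω i)}` with the SITE predicate
`D_s p := (p = 0 ∨ p = (s,0) ∨ (|p 1| < p 0 ∧ |p 1| < s - p 0)) ∧ 10 |p 1| ≤ s` (a self-avoiding walk `0 → (s,0)`
visits `0` only at time `0` and `(s,0)` only at time `n`, so the two filters agree; `SAW.Zd.mem_sawFun_iff_mem_saws`).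
(1) Corners `Q_j = (x_j, y_j) = (⌊ja/n⌋, ⌊jb/n⌋)`, `n = min(20, a)` (`CornerStaircase.nR/xc/yc`, `corner_facts`,
`corner_real`, `alpha_facts`, `cast_le_ell0` are reusable as they stand).  Round `j+1`: the horizontal diamond piece of
span `x_{j+1} - x_j ≥ 1` translated to `Q_j`, then the vertical diamond piece of span `y_{j+1} - y_j ≥ 0` (coordinate
swap of a horizontal one, `CornerStaircase.tubeMass_swap_le`; span `0` = the trivial walk,
`CornerStaircase.one_le_tubeMass_zero`).  (2) GLUING by `CornerStaircase.tubeMass_concat`, `2n` times, with the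
regions `R_k = {p | p 0 + p 1 < φ_k} ∪ {P_k} ∩ tube` where `P_k` is the current corner and `φ_k = P_k 0 + P_k 1`:
the separation hypothesis `hsep` holds because an interior point `q` of the new piece has `q 0 + q 1 > 0`
(east piece: `q 0 > |q 1| ≥ -q 1`; north piece: `q 1 > |q 0| ≥ -q 0`) and its far endpoint has `φ = span > 0`,
while every point of `R_k` other than `P_k` has `φ < φ_k`.  (3) TUBE by `infDist_segment_le_coord a b p (p 0 / a)`
(or `(x_{j+1}/a)` on vertical pieces): `|p 1 - b p 0 / a| ≤ (b/a)(a/n + 1) + 1 + (a/n + 1)/10 ≤ a/10 + 2` for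
`20 ≤ a` (`b ≤ a`), and `≤ 2` for `a < 20` (pieces of span `≤ 2`, half-width `0`); compare
`CornerStaircase.tube_of_H/tube_of_V`.  (4) MASS: each of the `≤ 40` pieces has span `≤ a ≤ ℓ₀`, so mass
`≥ min(c,1) ℓ₀^{-C}` (`Real.rpow_le_rpow_of_nonpos`, `C ≥ 0`; span `0`: mass `≥ 1`), product `≥ min(c,1)^{40} ℓ₀^{-40C}`
(pad with factors `≤ 1` when `n < 20`); `N` = the sum of the pieces' `N`.  `a = 0`: the trivial walk. -/
theorem stub_diamondStaircase :
    (∃ C c : ℝ, 0 ≤ C ∧ 0 < c ∧ ∀ s : ℕ, 1 ≤ s → ∃ N : ℕ,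
      c * (s : ℝ) ^ (-C) ≤
        ∑ n ∈ Finset.range (N + 1),
          ∑ _ω ∈ (SAW.Zd.saws 2 n).filter (fun ω =>
              ω n 0 = (s : ℤ) ∧ ω n 1 = 0 ∧
              (∀ i, 1 ≤ i → i < n → |ω i 1| < ω i 0 ∧ |ω i 1| < (s : ℤ) - ω i 0) ∧
              (∀ i ≤ n, 10 * |ω i 1| ≤ (s : ℤ))),
            SAW.criticalFugacity ^ n) →
    FirstOctantTubeFloor :=
  Summit.CriticalPhenomena.SAWScalingLimit.Theorems.TubeLowerBound.BridgeDoublingTower.stub_diamondStaircase  -- LANDED p113072 (lead c2 wave 2)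

/-! ## The composition -/

/-- **Composition**: S1 → S2 → S3 give `FirstOctantTubeFloor`; the landed octant reduction
(`LiebSimonStar.stub_octantReduction`, dihedral + translation transport) gives `TightTubeFloor`, which is the
crux at its own scale (`LiebSimonStar.tightTubeFloor_iff_crux`, from the landed `Negative.tightTubeFloor_iff`):
`TubeLowerBound` BY NAME. -/
theorem TubeLowerBound_of : TubeLowerBound :=
  tightTubeFloor_iff_crux.1
    (stub_octantReduction (stub_diamondStaircase (stub_doublingUpgrade stub_wedgeSlabFloor)))

/-! ## Negative knowledge checked against (landed `Theorems/TubeLowerBound/Negative/*`, imported above) -/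

/-- The refuted FIXED-WIDTH variant (tube radius not tied to `|u − v|`): every region in S1–S3 widens linearly with
the span, so no stub is an instance. -/
example : ¬ (∃ C c : ℝ, 0 < c ∧ ∀ (u v : Site 2) (ℓ : ℝ), 1 ≤ ℓ →
    ∃ N : ℕ, c * ℓ ^ (-C) ≤
      Summit.CriticalPhenomena.SAWScalingLimit.Theorems.TubeLowerBound.Negative.tubeMass
        SAW.criticalFugacity u v (ℓ / 10 + 2) N) :=
  Summit.CriticalPhenomena.SAWScalingLimit.Theorems.TubeLowerBound.Negative.not_withoutDist

end Summit.CriticalPhenomena.SAWScalingLimit.Cruxes.TubeLowerBound.BridgeDoublingTower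

end
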